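import Summits.QuantumFields.BalabanUV.T4Continuum.Support.NE7CriticalFirstVariation
import Summits.QuantumFields.BalabanUV.T4Continuum.Support.NE7ExactCurrent
import Summits.QuantumFields.BalabanUV.T4Continuum.Support.NE7SkewTorusForms
import HarnessLib

/-!
# NE7CriticalTensionLetter — [B8] (1.9) AT A TANGENT-CRITICAL CONFIGURATION, POINTWISE: the covariant codifferential of the flux form
# (the TENSION `T_ν(x) = Σ_μ ∇_μ† B_{μν}(x)`, gen 62's `NE7TensionPairing`) of a tangent-critical admissible configuration with flat top average is
# bounded AT EVERY BOND by `card n·(c_R(Λ + (L∕L^d)^{k+1}) + 12·#Plane·a²)` — the currency `C·δ·M⁻³` of R1, now per bond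

Cell `pub-balaban`, rung (B)+1 sub-cell t4, lineage `b2b-balaban-t4-ne7-p1`, generation 72 (CRUX PROVER NE7 #1, OWNER row NE7).  File R2 of the REP♭ road
(memo `t4/b2b-balaban-t4-ne7-p1-g72/HUNT-H16-GREEN-DISCHARGED.md` §7 (R-a), §9): [Balaban1985RegularSpaces] Theorem 2 asks of the configuration, besides the
plaquette smallness (1.7), the pointwise smallness (1.9) `|(D*_U ∂U)(b)| < α₀η³` of the covariant divergence of the field strength.  R1
(`NE7CriticalFirstVariation.abs_dAction_le_of_tanCritical`, p393495) proved the INTEGRATED form: tangent-criticality ⟹ `|dAction_U Z| ≤ c_R(Λ + (L∕L^d)^{k+1})·‖Z‖₁`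
for every skew periodic `Z`.  THIS FILE makes it POINTWISE, in the tree's own log-chart vocabulary: gen 62's `NE7TensionPairing` ∕ `NE7ExactCurrent` identify the
first variation with the pairing against the tension `T_ν(x) := Σ_μ cDstar U μ (B · μ ν) x` of the antisymmetrised flux form `B` (`B_{μν} = flux U (x; μ<ν) = log U(∂p)`)
up to `12·#Plane·a²·‖Z‖₁`; testing with the periodic ONE-BOND direction carrying `X = Ad_{U(b)}⁻¹ T(b)` and the Hilbert–Schmidt duality `‖T‖² ≤ card n·hsR T T` give
**`norm_tension_le_of_tanCritical`**: `‖T_ν(x)‖ ≤ card n·(c_R(Λ + (L∕L^d)^{k+1}) + 12·#Plane(d)·a²)` at every bond of the period box.  With `a = δM⁻²` and R1's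
`density_currency` the right side is `card n·(C(1+2C_Sα̂)·δ + 12·#Plane·δ²∕M)·M⁻³` — B8's `α₀η³` with `α₀ ∝ δ` (B8's (1.2) `D*∂U` is the group-valued divergence;
it differs from the log-chart tension by `O(a²) = O(δ²M⁻⁴)` per bond, `U(∂p) − 1 − log U(∂p) = O(|log U(∂p)|²)` — not needed here and not typed).
WHAT ([folklore]; 0 def, 0 sorry; every dimension `d`; the one-bond test direction is written out as a lambda).  §1 `plaqsOf_periodBox`;
**`abs_tension_pairing_le_of_tanCritical`** (R1 + `NE7ExactCurrent.dAction_sub_tension_pairing_le`: the integrated tension letter).  §2 the periodic one-bond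
direction: `isSkewDir_bump`, `isPeriodicDir_bump`, `dvd_iff_eq_of_mem_periodBox`, `dirL1_bump`, `pairing_bump`.  §3 `tension_mem_skewAdjoint`
(the tree's `NE7SkewTorusForms.fluxForm_skew`∕`cDstar_skew`), `norm_le_card_mul_of_hsR_le` (duality).  §4 **`norm_tension_le_of_tanCritical`**.
HONEST FRAMING (page 1): a LETTER about ONE configuration under displayed hypotheses (tangent-criticality, flat top average, the tower letter `Λ`, class radius);
it is the (1.9)-type INPUT of [B8] Theorem 2 in the tree's log chart, NOT that theorem; REP♭ NOT proved; (APE) NOT proved unconditionally; NOT ONE-STEP, NOT NE7;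
spine 0∕9; finite T⁴ rung (B)+1 — NOT infinite volume, NOT mass gap, NOT Clay.  Continuum YM on T⁴ ⇐ BetaPertH ∧ nine spine estimates (0/9 proved);
BetaPertH ⇐ (D1) ∧ (D4) ∧ CAP+tail; G-an2-4 gates asym, D1 and NE2/3/4.
-/

set_option autoImplicit false

open scoped BigOperators Matrix.Norms.L2Operator
open NormedSpace Finset

namespace Summit.QuantumFields.BalabanUV.T4Continuum.NE7CriticalTensionLetter

open Literature.MathematicalPhysics.QuantumFieldTheory.Balaban1983to89
open B7Prop1Explicit B7Prop2Explicit MatrixLog UnitaryModel MatrixNorms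
open T4AveragingDeficitWall (IsUnitaryCfg IsSkewDir SmallField dirL1 Ad flux)
open T4AveragingDeficitWallBoundary (IsPeriodicCfg periodBox mem_periodBox)
open AveragingDeficitTransport (norm_Ad_of_unitary Ad_mem_skewAdjoint)
open AveragingDeficitPeriodicCounting (IsPeriodicDir)
open AveragingDeficitMultiLevelPrep (cavgIter LevelSmall)
open MinimalActionLevels (perWin)
open BlockAveragePushDirSplit (flat)
open NE3TangentCovariantTower (dirIter QbarIter)
open NE3HessForm (dAction)
open NE3HessShapes (plaqsOf)
open NE3CovariantCalculus (hsR cDstar hsR_self)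
open NE3CovariantWeitzenbock (frame)
open NE3LandauOrbit (hsR_zero_left)
open NE3GaugeDirFrames (Ad_Ad_inv)
open NE3QbarIterCovLiftPrep (cruxC)
open NE3RightInverseSolveLetters (thetaLoc)
open NE3HatInvCurlLetters (curl1C curl1C_nonneg)
open NE7SkewTorusForms (fluxForm_skew cDstar_skew)
open NE7CriticalFirstVariation (abs_dAction_le_of_tanCritical)
open NE7ExactCurrent (dAction_sub_tension_pairing_le)

noncomputable section

variable {d : ℕ} {n : Type*} [Fintype n] [DecidableEq n]

/-! ## §1 The integrated tension letter -/

omit [Fintype n] [DecidableEq n] in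
/-- The plaquette window over a period box IS the period window. [folklore] -/
theorem plaqsOf_periodBox (P : ℕ) : plaqsOf (periodBox (d := d) P) = perWin d P := rfl

/-- **THE INTEGRATED TENSION LETTER OF A TANGENT-CRITICAL CONFIGURATION.**  Under R1's hypotheses (`U` unitary `(N·L^{k+1})`-periodic, class radius `x`
with `LevelSmall`, `cruxC·M²x < 1`, `thetaLoc·M²x < 1`, `M²x ≤ 1`, plaquette radius `0 ≤ a ≤ 1∕4`, flat top average, tower letter `Λ`, TANGENT-CRITICALITY) and for
the antisymmetrised flux form `B` of `U`: for every skew periodic `Z`,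
`|Σ_{y ∈ periodBox} Σ_ν hsR (frame U Z y ν) (T_ν(y))| ≤ (c_R·(Λ + (L∕L^d)^{k+1}) + 12·#Plane·a²)·‖Z‖_{ℓ¹(periodBox)}`, `T_ν(y) = Σ_μ cDstar U μ (B · μ ν) y`.
(R1 `abs_dAction_le_of_tanCritical` + gen 62's `NE7ExactCurrent.dAction_sub_tension_pairing_le`.) [folklore] -/
theorem abs_tension_pairing_le_of_tanCritical [Nonempty n] {L : ℕ} (hL : 2 ≤ L) (k : ℕ) {N : ℕ} [NeZero N]
    {U : Site d → Fin d → (Matrix n n ℂ)ˣ} {x a Λ : ℝ}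
    (hUu : IsUnitaryCfg U) (hUP : IsPeriodicCfg U ((N * L ^ (k + 1) : ℕ) : ℤ)) (hx : 0 ≤ x) (hs : LevelSmall d L k x) (hUx : SmallField U x)
    (hθ : cruxC d L * (((L : ℝ) ^ (k + 1)) ^ 2 * x) < 1) (hθl : thetaLoc d L * (((L : ℝ) ^ (k + 1)) ^ 2 * x) < 1)
    (hε : ((L : ℝ) ^ (k + 1)) ^ 2 * x ≤ 1) (ha : 0 ≤ a) (ha4 : a ≤ 1 / 4) (hUa : SmallField U a)
    (hflatTop : cavgIter L (k + 1) U = flat)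
    (hΛ : ∀ Y : Site d → Fin d → Matrix n n ℂ, IsSkewDir Y → IsPeriodicDir Y ((N * L ^ (k + 1) : ℕ) : ℤ) →
      ∑ z ∈ periodBox N, ∑ κ : Fin d, ‖QbarIter L (k + 1) U Y z κ - QbarIter L (k + 1) (flat (d := d) (n := n)) Y z κ‖
        ≤ Λ * dirL1 Y (periodBox (d := d) (N * L ^ (k + 1))))
    (hcrit : ∀ Y' : Site d → Fin d → Matrix n n ℂ, IsSkewDir Y' → IsPeriodicDir Y' ((N * L ^ (k + 1) : ℕ) : ℤ) →
      dirIter L (k + 1) U Y' = 0 → dAction U Y' (perWin d (N * L ^ (k + 1))) = 0)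
    {B : Site d → Fin d → Fin d → Matrix n n ℂ}
    (hBF : ∀ (y : Site d) (μ ν : Fin d) (h : μ < ν), B y μ ν = flux U (y, ⟨(μ, ν), h⟩))
    (hanti : ∀ (y : Site d) (μ ν : Fin d), B y ν μ = -B y μ ν)
    {Z : Site d → Fin d → Matrix n n ℂ} (hZ : IsSkewDir Z) (hZP : IsPeriodicDir Z ((N * L ^ (k + 1) : ℕ) : ℤ)) :
    |∑ y ∈ periodBox (d := d) (N * L ^ (k + 1)), ∑ ν : Fin d, hsR (frame U Z y ν) (∑ μ : Fin d, cDstar U μ (fun w => B w μ ν) y)|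
      ≤ ((a * ((curl1C d L / (1 - thetaLoc d L * (((L : ℝ) ^ (k + 1)) ^ 2 * x))) * (((L : ℝ) ^ (k + 1)) ^ d / ((L : ℝ) ^ (k + 1)) ^ 2)))
            * (Λ + ((L : ℝ) / (L : ℝ) ^ d) ^ (k + 1))
          + 12 * (Fintype.card (T4AveragingDeficitWall.Plane d) : ℝ) * a ^ 2) * dirL1 Z (periodBox (d := d) (N * L ^ (k + 1))) := by
  have h1 := abs_dAction_le_of_tanCritical hL k hUu hUP hx hs hUx hθ hθl hε ha hUa hflatTop hΛ hcrit hZ hZP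
  have hP1 : 1 ≤ N * L ^ (k + 1) := Nat.one_le_iff_ne_zero.mpr (Nat.mul_ne_zero (NeZero.ne N) (pow_ne_zero _ (by omega)))
  have h2 := dAction_sub_tension_pairing_le hP1 hUu hUP ha ha4 hUa hZ hZP hBF hanti
  rw [plaqsOf_periodBox] at h2
  have h3 := abs_sub_abs_le_abs_sub (∑ y ∈ periodBox (d := d) (N * L ^ (k + 1)), ∑ ν : Fin d,
      hsR (frame U Z y ν) (∑ μ : Fin d, cDstar U μ (fun w => B w μ ν) y)) (dAction U Z (perWin d (N * L ^ (k + 1))))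
  rw [abs_sub_comm] at h2
  have h4 : |∑ y ∈ periodBox (d := d) (N * L ^ (k + 1)), ∑ ν : Fin d, hsR (frame U Z y ν) (∑ μ : Fin d, cDstar U μ (fun w => B w μ ν) y)|
      ≤ |dAction U Z (perWin d (N * L ^ (k + 1)))|
        + 12 * (Fintype.card (T4AveragingDeficitWall.Plane d) : ℝ) * a ^ 2 * dirL1 Z (periodBox (d := d) (N * L ^ (k + 1))) := by
    linarith
  rw [add_mul]
  linarith [h1, h4]

/-! ## §2 The periodic one-bond test direction `ψ(y, ι) = X` on the `P`-translates of the bond `(x₀, ν₀)`, `0` elsewhere -/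

omit [Fintype n] [DecidableEq n] in
/-- The one-bond direction is skew when `X` is. [folklore] -/
theorem isSkewDir_bump (P : ℕ) (x₀ : Site d) (ν₀ : Fin d) {X : Matrix n n ℂ} (hX : X ∈ skewAdjoint (Matrix n n ℂ)) :
    IsSkewDir (fun (y : Site d) (ι : Fin d) => if ι = ν₀ ∧ (∀ i, (P : ℤ) ∣ y i - x₀ i) then X else 0) := by
  intro y ι
  dsimp only
  split_ifs
  · exact hX
  · exact (skewAdjoint _).zero_mem

omit [Fintype n] [DecidableEq n] in
/-- The one-bond direction is `P`-periodic. [folklore] -/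
theorem isPeriodicDir_bump (P : ℕ) (x₀ : Site d) (ν₀ : Fin d) (X : Matrix n n ℂ) :
    IsPeriodicDir (fun (y : Site d) (ι : Fin d) => if ι = ν₀ ∧ (∀ i, (P : ℤ) ∣ y i - x₀ i) then X else 0) (P : ℤ) := by
  intro y κ μ
  have hiff : (∀ i, (P : ℤ) ∣ (y + (P : ℤ) • e κ) i - x₀ i) ↔ (∀ i, (P : ℤ) ∣ y i - x₀ i) := by
    refine forall_congr' fun i => ?_
    rw [Pi.add_apply, Pi.smul_apply, smul_eq_mul, show y i + (P : ℤ) * e κ i - x₀ i = (y i - x₀ i) + (P : ℤ) * e κ i by ring]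
    exact ⟨fun h => by simpa using dvd_sub h (dvd_mul_right (P : ℤ) (e κ i)), fun h => dvd_add h (dvd_mul_right _ _)⟩
  dsimp only
  simp only [hiff]

omit [Fintype n] [DecidableEq n] in
/-- Two points of the period box whose coordinates are congruent mod `P` are equal. [folklore] -/
theorem dvd_iff_eq_of_mem_periodBox {P : ℕ} {x₀ y : Site d} (hx₀ : x₀ ∈ periodBox (d := d) P) (hy : y ∈ periodBox (d := d) P) :
    (∀ i, (P : ℤ) ∣ y i - x₀ i) ↔ y = x₀ := by
  rw [mem_periodBox] at hx₀ hy
  refine ⟨fun h => funext fun i => ?_, fun h i => by rw [h, sub_self]; exact dvd_zero _⟩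
  have hi := h i
  have h0 := hx₀ i
  have h1 := hy i
  have habs : |y i - x₀ i| < (P : ℤ) := by rw [abs_lt]; constructor <;> omega
  have := Int.eq_zero_of_abs_lt_dvd hi habs
  omega

/-- The `ℓ¹` norm over the period box of the one-bond direction at a bond of the box is `‖X‖`. [folklore] -/
theorem dirL1_bump {P : ℕ} {x₀ : Site d} (hx₀ : x₀ ∈ periodBox (d := d) P) (ν₀ : Fin d) (X : Matrix n n ℂ) :
    dirL1 (fun (y : Site d) (ι : Fin d) => if ι = ν₀ ∧ (∀ i, (P : ℤ) ∣ y i - x₀ i) then X else 0) (periodBox (d := d) P) = ‖X‖ := by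
  unfold dirL1
  rw [Finset.sum_eq_single_of_mem x₀ hx₀ fun y hy hne => ?_]
  · rw [Finset.sum_eq_single ν₀ (fun κ _ hne => ?_) (by simp)]
    · dsimp only
      rw [if_pos ⟨rfl, fun i => by rw [sub_self]; exact dvd_zero _⟩]
    · dsimp only
      rw [if_neg (fun h => hne h.1), norm_zero]
  · refine Finset.sum_eq_zero fun κ _ => ?_
    dsimp only
    rw [if_neg (fun h => hne ((dvd_iff_eq_of_mem_periodBox hx₀ hy).mp h.2)), norm_zero]

/-- The framed pairing of the one-bond direction against any bond field picks out ONE term: `hsR (Ad_{U(x₀,ν₀)} X) (T x₀ ν₀)`. [folklore] -/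
theorem pairing_bump (U : Site d → Fin d → (Matrix n n ℂ)ˣ) {P : ℕ} {x₀ : Site d} (hx₀ : x₀ ∈ periodBox (d := d) P) (ν₀ : Fin d)
    (X : Matrix n n ℂ) (T : Site d → Fin d → Matrix n n ℂ) :
    ∑ y ∈ periodBox (d := d) P, ∑ ν : Fin d,
        hsR (frame U (fun (y : Site d) (ι : Fin d) => if ι = ν₀ ∧ (∀ i, (P : ℤ) ∣ y i - x₀ i) then X else 0) y ν) (T y ν)
      = hsR (Ad (U x₀ ν₀) X) (T x₀ ν₀) := by
  have hAd0 : ∀ u : (Matrix n n ℂ)ˣ, Ad u (0 : Matrix n n ℂ) = 0 := fun u => by simp [Ad]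
  rw [Finset.sum_eq_single_of_mem x₀ hx₀ fun y hy hne => ?_]
  · rw [Finset.sum_eq_single ν₀ (fun κ _ hne => ?_) (by simp)]
    · unfold frame
      dsimp only
      rw [if_pos ⟨rfl, fun i => by rw [sub_self]; exact dvd_zero _⟩]
    · simp only [frame]
      rw [if_neg (fun h => hne h.1), hAd0, hsR_zero_left]
  · refine Finset.sum_eq_zero fun κ _ => ?_
    simp only [frame]
    rw [if_neg (fun h => hne ((dvd_iff_eq_of_mem_periodBox hx₀ hy).mp h.2)), hAd0, hsR_zero_left]

/-! ## §3 Skewness of the tension; Hilbert–Schmidt duality -/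

/-- The tension `T_ν(y) = Σ_μ cDstar U μ (B · μ ν) y` of a unitary configuration of plaquette radius `≤ 1∕4` is skew (the tree's
`NE7SkewTorusForms.fluxForm_skew` and `cDstar_skew`). [folklore] -/
theorem tension_mem_skewAdjoint [Nonempty n] {U : Site d → Fin d → (Matrix n n ℂ)ˣ} (hUu : IsUnitaryCfg U) {a : ℝ} (ha4 : a ≤ 1 / 4)
    (hUa : SmallField U a) {B : Site d → Fin d → Fin d → Matrix n n ℂ}
    (hBF : ∀ (y : Site d) (μ ν : Fin d) (h : μ < ν), B y μ ν = flux U (y, ⟨(μ, ν), h⟩))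
    (hanti : ∀ (y : Site d) (μ ν : Fin d), B y ν μ = -B y μ ν) (y : Site d) (ν : Fin d) :
    (∑ μ : Fin d, cDstar U μ (fun w => B w μ ν) y) ∈ skewAdjoint (Matrix n n ℂ) :=
  sum_mem fun μ _ => cDstar_skew hUu μ (fun w => fluxForm_skew hUu ha4 hUa hBF hanti w μ ν) y

/-- **HILBERT–SCHMIDT DUALITY**: `hsR T T ≤ K‖T‖` with `K ≥ 0` forces `‖T‖ ≤ card n·K` (`‖T‖² ≤ card n·nhsNormSq T = card n·hsR T T`). [folklore] -/
theorem norm_le_card_mul_of_hsR_le {T : Matrix n n ℂ} {K : ℝ} (hK : 0 ≤ K) (h : hsR T T ≤ K * ‖T‖) :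
    ‖T‖ ≤ Fintype.card n * K := by
  have h1 : ‖T‖ ^ 2 ≤ Fintype.card n * nhsNormSq T := opNorm_sq_le_card_mul_nhsNormSq T
  rw [← hsR_self] at h1
  have hn : (0 : ℝ) ≤ Fintype.card n := Nat.cast_nonneg _
  have h2 : ‖T‖ * ‖T‖ ≤ (Fintype.card n * K) * ‖T‖ := by
    calc ‖T‖ * ‖T‖ = ‖T‖ ^ 2 := by ring
      _ ≤ Fintype.card n * hsR T T := h1
      _ ≤ Fintype.card n * (K * ‖T‖) := mul_le_mul_of_nonneg_left h hn
      _ = (Fintype.card n * K) * ‖T‖ := by ring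
  by_cases hT : ‖T‖ = 0
  · rw [hT]; positivity
  · exact le_of_mul_le_mul_right h2 (lt_of_le_of_ne (norm_nonneg _) (Ne.symm hT))

/-! ## §4 The pointwise tension letter -/

/-- **[B8] (1.9) AT A TANGENT-CRITICAL CONFIGURATION, POINTWISE (log chart).**  Under R1's hypotheses (as in `abs_tension_pairing_le_of_tanCritical`, with
`0 ≤ Λ`) the tension of the antisymmetrised flux form is bounded AT EVERY BOND `(x₀, ν₀)` of the period box:
`‖Σ_μ cDstar U μ (B · μ ν₀) x₀‖ ≤ card n·(c_R·(Λ + (L∕L^d)^{k+1}) + 12·#Plane(d)·a²)`, `c_R = a·(curl1C∕(1 − θℓ))·(M^d∕M²)`.  (Test the integrated letter with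
the periodic one-bond direction carrying `X = Ad_{U(x₀,ν₀)}⁻¹ T_{ν₀}(x₀)`, whose `ℓ¹` norm over the box is `‖T_{ν₀}(x₀)‖`; then Hilbert–Schmidt duality.)  With
`a = δM⁻²`, `Λ = 2C_Sα̂(L∕L^d)^{k+1}`: `≤ card n·(C(1+2C_Sα̂)δ + 12·#Plane·δ²∕M)·M⁻³` (R1 `density_currency`). [folklore] -/
theorem norm_tension_le_of_tanCritical [Nonempty n] {L : ℕ} (hL : 2 ≤ L) (k : ℕ) {N : ℕ} [NeZero N]
    {U : Site d → Fin d → (Matrix n n ℂ)ˣ} {x a Λ : ℝ}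
    (hUu : IsUnitaryCfg U) (hUP : IsPeriodicCfg U ((N * L ^ (k + 1) : ℕ) : ℤ)) (hx : 0 ≤ x) (hs : LevelSmall d L k x) (hUx : SmallField U x)
    (hθ : cruxC d L * (((L : ℝ) ^ (k + 1)) ^ 2 * x) < 1) (hθl : thetaLoc d L * (((L : ℝ) ^ (k + 1)) ^ 2 * x) < 1)
    (hε : ((L : ℝ) ^ (k + 1)) ^ 2 * x ≤ 1) (ha : 0 ≤ a) (ha4 : a ≤ 1 / 4) (hUa : SmallField U a)
    (hflatTop : cavgIter L (k + 1) U = flat) (hΛ0 : 0 ≤ Λ)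
    (hΛ : ∀ Y : Site d → Fin d → Matrix n n ℂ, IsSkewDir Y → IsPeriodicDir Y ((N * L ^ (k + 1) : ℕ) : ℤ) →
      ∑ z ∈ periodBox N, ∑ κ : Fin d, ‖QbarIter L (k + 1) U Y z κ - QbarIter L (k + 1) (flat (d := d) (n := n)) Y z κ‖
        ≤ Λ * dirL1 Y (periodBox (d := d) (N * L ^ (k + 1))))
    (hcrit : ∀ Y' : Site d → Fin d → Matrix n n ℂ, IsSkewDir Y' → IsPeriodicDir Y' ((N * L ^ (k + 1) : ℕ) : ℤ) →
      dirIter L (k + 1) U Y' = 0 → dAction U Y' (perWin d (N * L ^ (k + 1))) = 0)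
    {B : Site d → Fin d → Fin d → Matrix n n ℂ}
    (hBF : ∀ (y : Site d) (μ ν : Fin d), ∀ (h : μ < ν), B y μ ν = flux U (y, ⟨(μ, ν), h⟩))
    (hanti : ∀ (y : Site d) (μ ν : Fin d), B y ν μ = -B y μ ν)
    {x₀ : Site d} (hx₀ : x₀ ∈ periodBox (d := d) (N * L ^ (k + 1))) (ν₀ : Fin d) :
    ‖∑ μ : Fin d, cDstar U μ (fun w => B w μ ν₀) x₀‖
      ≤ Fintype.card n *
          ((a * ((curl1C d L / (1 - thetaLoc d L * (((L : ℝ) ^ (k + 1)) ^ 2 * x))) * (((L : ℝ) ^ (k + 1)) ^ d / ((L : ℝ) ^ (k + 1)) ^ 2)))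
              * (Λ + ((L : ℝ) / (L : ℝ) ^ d) ^ (k + 1))
            + 12 * (Fintype.card (T4AveragingDeficitWall.Plane d) : ℝ) * a ^ 2) := by
  -- the tension at the bond and the test matrix `X = Ad_{U(b)}⁻¹ T(b)`
  have hT : (∑ μ : Fin d, cDstar U μ (fun w => B w μ ν₀) x₀) ∈ skewAdjoint (Matrix n n ℂ) :=
    tension_mem_skewAdjoint hUu ha4 hUa hBF hanti x₀ ν₀
  have hu : U x₀ ν₀ ∈ unitaryUnits (Matrix n n ℂ) := hUu x₀ ν₀
  have hX : Ad (U x₀ ν₀)⁻¹ (∑ μ : Fin d, cDstar U μ (fun w => B w μ ν₀) x₀) ∈ skewAdjoint (Matrix n n ℂ) :=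
    Ad_mem_skewAdjoint ((unitaryUnits _).inv_mem hu) hT
  -- the integrated letter on the one-bond direction
  have hA := abs_tension_pairing_le_of_tanCritical hL k hUu hUP hx hs hUx hθ hθl hε ha ha4 hUa hflatTop hΛ hcrit hBF hanti
    (isSkewDir_bump (N * L ^ (k + 1)) x₀ ν₀ hX) (isPeriodicDir_bump (N * L ^ (k + 1)) x₀ ν₀ _)
  rw [pairing_bump U hx₀ ν₀ _ (fun y ν => ∑ μ : Fin d, cDstar U μ (fun w => B w μ ν) y), dirL1_bump hx₀, Ad_Ad_inv,
    norm_Ad_of_unitary ((unitaryUnits _).inv_mem hu)] at hA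
  -- nonnegativity of the constant
  have hK : 0 ≤ (a * ((curl1C d L / (1 - thetaLoc d L * (((L : ℝ) ^ (k + 1)) ^ 2 * x))) * (((L : ℝ) ^ (k + 1)) ^ d / ((L : ℝ) ^ (k + 1)) ^ 2)))
        * (Λ + ((L : ℝ) / (L : ℝ) ^ d) ^ (k + 1))
      + 12 * (Fintype.card (T4AveragingDeficitWall.Plane d) : ℝ) * a ^ 2 := by
    have hpos : 0 < 1 - thetaLoc d L * (((L : ℝ) ^ (k + 1)) ^ 2 * x) := by linarith
    have := curl1C_nonneg d L
    positivity
  exact norm_le_card_mul_of_hsR_le hK ((le_abs_self _).trans hA)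

end

end Summit.QuantumFields.BalabanUV.T4Continuum.NE7CriticalTensionLetter
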